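import Literature.NumberTheory.Sieve.AsymptoticSieveForPrimesTyz
import Literature.NumberTheory.Sieve.AsymptoticSieveForPrimesS2
import HarnessLib

/-!
# Asymptotic sieve for primes: `S₃(x; y, z)` — the `λ^±` split and the bound (8.1) for `S⁻` (proof)

Trunk T-SIEVE. Source: J. Friedlander, H. Iwaniec, *Asymptotic sieve for primes*, Ann. of Math. 148
(1998) 1041–1065 [FriedlanderIwaniecASP1998] (= arXiv:math/9811186), §8 "Estimation of
`S₃(x; Y, Z)`", p. 1057, up to display (8.1).

First of three files discharging the named fact `Literature.NumberTheory.Sieve.fi_asp_S3_estimate` (FI (8.5)) modulo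
FI (2.4) (`…S3Minus`: split and `S⁻`; `…S3Plus`: `S⁺ = S* + S'`; `…S3`: assembly).

## The printed proof (FI §8, first part) and its formalisation

"Recall that `S₃(x; y, z) = ∑_e ∑_{b>sy} μ(b) ∑_{z<c≤sz} Λ(c) ρ_{eb} a_{ebc}`. Here we have, for the
first time, taken advantage of the fact that `ρ_{ebc} = ρ_{eb}` since `c` is prime. In essence this
sum is of the same type as that in the previous section but with `b` and `c` interchanged. Thus by
analogy to the previous argument, we put `c` into the inner summation because its range is
appropriate for (B′). However, the fact that `c` is weighted by `Λ` rather than `μ` necessitates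
splitting it further in order to obtain a factor with sign changes from which we may hope to detect
cancellation. We write `μ(c)Λ(c) = ∑_{m∣c} μ(m) log(m/C)·… = λ⁺(c) - λ⁻(c)` (recall `c` is squarefree)
with `C = xD⁻¹` where `λ⁺(c) = ∑_{m∣c} μ(m) log⁺(m/C)`, `λ⁻(c) = ∑_{m∣c} μ(m) log⁺(C/m)`. Note that
the definition of `λ⁻(c)` is close to `γ(c, C)` in (B2); precisely we have
`λ⁻(c) = ∫_1^C γ(c, t) t⁻¹ dt`. This gives a contribution to `S₃(x; y, z)` which, by virtue of (B′)
applied `log₂ s` times, satisfies (8.1) `|S⁻(x; y, z)| ≤ ∑_ℓ τ₄(ℓ) |∑_{z<c≤sz} μ(c)λ⁻(c) a_{cℓ}|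
≪ A(x)(log x)⁻¹`."

* `SieveSequence.fiS3_eq_sum_sum`: `S₃ = ∑_{c ≤ x} ∑_{k ≤ x/c} Λ(z<c≤sz) M(k) ρ_k a_{kc}` with
  `k = eb`, `M(k) = ∑_{b∣k} μ(b > sy)` (`sum_Icc_mul_conv_eq` of `…S2`) and `ρ_{kc} = ρ_k`
  (`sieveRho_mul_prime`: a prime power `c` with `a_{kc} ≠ 0` is a prime beyond the sifting range).
* `sum_divisors_moebius_posLog_sub`, `vonMangoldt_mul_a_eq`: `μ(c)Λ(c) = λ⁺(c) - λ⁻(c)` for `c ≥ 2`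
  (Mathlib's `sum_moebius_mul_log_eq`, `log⁺ t - log⁺ t⁻¹ = log t`), hence
  `SieveSequence.fiS3_eq_plus_sub_minus`: `S₃ = S⁺ - S⁻`. We take the truncation point to be the
  INTEGER `C₀ = ⌈x/D⌉ ≥ x/D` (any `C₀ ≥ x/D` with `C₀ - 1 < x/D` works: `λ⁺` keeps `d = kℓ < D` for
  (R′), `λ⁻` keeps the truncations `j < C₀ ≤ x/D` inside (B3)).
* `sum_divisors_moebius_posLog_eq_sum_gamma`: the discrete form of `λ⁻(c) = ∫_1^C γ(c,t) dt/t`,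
  `∑_{m∣c} μ(m) log⁺(C₀/m) = ∑_{1 ≤ j < C₀} log((j+1)/j) γ(c; j)` (interchange and telescope).
* `abs_S3minus_le`: (8.1) — swap to `∑_k M(k)ρ_k ∑_c`, `|M(k)|ρ_k ≤ τ(k)² ≤ τ₅(k)` on squarefree `k`,
  `γ(c;j)μ(c)a_{kc} = μ(k)·γ(c;j)μ(kc)a_{kc}` (`sum_gamma_moebius_mul_a_eq`), the dyadic pieces of
  `(z, sz]` (`sum_ite_Ioc_pow_eq_sum_range` of `…S2`) and (B′) on each piece and each `j`:
  `|S⁻(x; y, z)| ≤ log C₀ · log₂ s · K_B` (with `K_B = K A(x)(log x)^{-5}` in the assembly).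

## Mathlib search

Mathlib: `ArithmeticFunction.sum_moebius_mul_log_eq` (`∑_{d∣n} μ(d) log d = -Λ(n)`),
`Real.posLog` with `posLog_sub_posLog_inv`, `posLog_eq_zero_iff`, `Finset.sum_Ico_sub`
(telescoping), `Nat.sum_divisorsAntidiagonal'`; the tree: `…S2` (`sum_Icc_mul_conv_eq`,
`sum_Icc_sum_divisorsAntidiagonal_eq`, `sum_ite_Ioc_pow_eq_sum_range`), `…Inputs`
(`IsUpperSieveWeights.sieveRho_mul_prime`), `…Tyz` (`card_divisors_sq_le_divisorCountK_five`),
`…Assembly` (`abs_truncGT_moebius_le`). Nothing on `λ^±` or `S⁻` (`lean search 'posLog'` in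
Literature/NumberTheory: no hits).
-/

noncomputable section

open Filter Finset
open scoped ArithmeticFunction.Moebius ArithmeticFunction.vonMangoldt ArithmeticFunction.zeta
  ArithmeticFunction.omega ArithmeticFunction.sigma

namespace Literature.NumberTheory.Sieve

/-! ### The weights `λ⁺(c)`, `λ⁻(c)` (FI §8) -/

/-- **`μ(c)Λ(c) = λ⁺(c) - λ⁻(c)`** (FI §8: "We write `μ(c)Λ(c) = ∑_{m∣c} μ(m) log(m/C)·… = λ⁺(c) - λ⁻(c)`
(recall `c` is squarefree) with `C = xD⁻¹` where `λ⁺(c) = ∑_{m∣c} μ(m) log⁺(m/C)`,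
`λ⁻(c) = ∑_{m∣c} μ(m) log⁺(C/m)`"), in the form valid for every `c ≥ 2` and `C > 0`:
`∑_{m∣c} μ(m) log⁺(m/C) - ∑_{m∣c} μ(m) log⁺(C/m) = -Λ(c)` (`log⁺ t - log⁺ t⁻¹ = log t`,
`∑_{m∣c} μ(m) log m = -Λ(c)`, `∑_{m∣c} μ(m) = 0`). [cite: FriedlanderIwaniecASP1998, §8 p. 1057] -/
theorem sum_divisors_moebius_posLog_sub {C : ℝ} (hC : 0 < C) {c : ℕ} (hc : 2 ≤ c) :
    ∑ m ∈ c.divisors, (μ m : ℝ) * Real.posLog (m / C) -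
      ∑ m ∈ c.divisors, (μ m : ℝ) * Real.posLog (C / m) = -Λ c := by
  rw [← Finset.sum_sub_distrib]
  have h1 : ∀ m ∈ c.divisors, (μ m : ℝ) * Real.posLog (m / C) - (μ m : ℝ) * Real.posLog (C / m) =
      (μ m : ℝ) * Real.log m - (μ m : ℝ) * Real.log C := by
    intro m hm
    have hm0 : (0 : ℝ) < m := by exact_mod_cast Nat.pos_of_mem_divisors hm
    rw [← mul_sub, show C / (m : ℝ) = ((m : ℝ) / C)⁻¹ by rw [inv_div], Real.posLog_sub_posLog_inv,
      Real.log_div hm0.ne' hC.ne', mul_sub]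
  have h3 : ∑ m ∈ c.divisors, (μ m : ℝ) * Real.log m = -Λ c := by
    have := ArithmeticFunction.sum_moebius_mul_log_eq (n := c)
    simpa only [ArithmeticFunction.log_apply] using this
  rw [Finset.sum_congr rfl h1, Finset.sum_sub_distrib, h3, ← Finset.sum_mul]
  have h2 : ∑ m ∈ c.divisors, (μ m : ℝ) = 0 := by
    have h := congrArg (fun f : ArithmeticFunction ℤ => f c) ArithmeticFunction.moebius_mul_coe_zeta
    simp only [ArithmeticFunction.coe_mul_zeta_apply, ArithmeticFunction.one_apply] at h
    rw [if_neg (by omega)] at h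
    exact_mod_cast h
  rw [h2, zero_mul, sub_zero]

/-- A squarefree prime power is a prime: if `Λ(c) ≠ 0` and `c` is squarefree then `c` is prime.
[folklore] -/
theorem prime_of_vonMangoldt_ne_zero_of_squarefree {c : ℕ} (hΛ : Λ c ≠ 0) (hc : Squarefree c) :
    c.Prime := by
  rw [Ne, ArithmeticFunction.vonMangoldt_eq_zero_iff, not_not] at hΛ
  obtain ⟨p, k, hp, hk, rfl⟩ := hΛ
  rcases Nat.lt_or_ge 1 k with hk1 | hk1
  · exfalso
    have hdvd : p * p ∣ p ^ k := by
      rw [← sq]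
      exact pow_dvd_pow p hk1
    exact hp.not_unit (hc p hdvd)
  · have hk' : k = 1 := le_antisymm hk1 hk
    subst hk'
    rw [pow_one]
    exact Nat.prime_iff.mpr hp

/-- **`Λ(c) a_{kc} = μ(c)(λ⁺(c) - λ⁻(c)) a_{kc}`** for `c ≥ 2` under (1.16) (if `kc` is squarefree then
`μ(c)² = 1`; otherwise `a_{kc} = 0`). [cite: FriedlanderIwaniecASP1998, §8 p. 1057] -/
theorem vonMangoldt_mul_a_eq {A : SieveSequence} (h116 : ∀ n : ℕ, ¬Squarefree n → A.a n = 0)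
    {C : ℝ} (hC : 0 < C) (k : ℕ) {c : ℕ} (hc : 2 ≤ c) :
    Λ c * A.a (k * c) =
      (μ c : ℝ) * (∑ m ∈ c.divisors, (μ m : ℝ) * Real.posLog (m / C) -
        ∑ m ∈ c.divisors, (μ m : ℝ) * Real.posLog (C / m)) * A.a (k * c) := by
  rw [sum_divisors_moebius_posLog_sub hC hc]
  by_cases hsq : Squarefree (k * c)
  · by_cases hΛ : Λ c = 0
    · rw [hΛ, neg_zero, zero_mul, mul_zero, zero_mul]
    · have hcp : c.Prime := prime_of_vonMangoldt_ne_zero_of_squarefree hΛ (Squarefree.of_mul_right hsq)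
      rw [ArithmeticFunction.moebius_apply_prime hcp]
      push_cast
      ring
  · rw [h116 _ hsq, mul_zero, mul_zero]

/-! ### `S₃(x; y, z)` grouped by `k = eb` -/

/-- Swapping the order in a sum over `kc ≤ X`: `∑_{c ≤ X} ∑_{k ≤ X/c} F(k, c) = ∑_{k ≤ X} ∑_{c ≤ X/k} F(k, c)`.
[folklore] -/
theorem sum_Icc_div_comm {M : Type*} [AddCommMonoid M] (F : ℕ → ℕ → M) (X : ℕ) :
    ∑ c ∈ Icc 1 X, ∑ k ∈ Icc 1 (X / c), F k c = ∑ k ∈ Icc 1 X, ∑ c ∈ Icc 1 (X / k), F k c := by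
  rw [← sum_Icc_sum_divisorsAntidiagonal_eq (fun p : ℕ × ℕ => F p.1 p.2) X,
    ← sum_Icc_sum_divisorsAntidiagonal_eq (fun p : ℕ × ℕ => F p.2 p.1) X]
  refine Finset.sum_congr rfl fun n _ => ?_
  rw [Nat.sum_divisorsAntidiagonal' (fun a b => F a b), Nat.sum_divisorsAntidiagonal (fun a b => F b a)]

namespace SieveSequence

variable {A : SieveSequence}

/-- **`S₃` grouped** (FI §8: "`S₃(x; y, z) = ∑_e ∑_{b>sy} μ(b) ∑_{z<c≤sz} Λ(c) ρ_{eb} a_{ebc}`. Here we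
have, for the first time, taken advantage of the fact that `ρ_{ebc} = ρ_{eb}` since `c` is prime"):
for weights of sifting range `P ≤ z`, `S₃(x; y, z) = ∑_{c ≤ x} ∑_{k ≤ x/c} Λ(z < c ≤ sz) M(k) ρ_k a_{kc}`
with `M(k) = ∑_{b ∣ k} μ(b > sy)` (a prime power `c` with `a_{kc} ≠ 0` is a prime `> P`, so
`ρ_{kc} = ρ_k`). [cite: FriedlanderIwaniecASP1998, §8 p. 1057] -/
theorem fiS3_eq_sum_sum (A : SieveSequence) (h116 : ∀ n : ℕ, ¬Squarefree n → A.a n = 0)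
    {P L : ℝ} {lam : ℕ → ℤ} (hw : IsUpperSieveWeights P L lam) {s x y z : ℝ} (hPz : P ≤ z) :
    A.fiS3 lam s x y z = ∑ c ∈ Icc 1 ⌊x⌋₊, ∑ k ∈ Icc 1 (⌊x⌋₊ / c), truncIoc Λ z (s * z) c *
      ((truncGT (μ : ArithmeticFunction ℝ) (s * y) * ζ) k * ((sieveRho lam k : ℝ) * A.a (k * c))) := by
  have hF : truncGT (μ : ArithmeticFunction ℝ) (s * y) * truncIoc Λ z (s * z) * ζ =
      (truncGT (μ : ArithmeticFunction ℝ) (s * y) * ζ) * truncIoc Λ z (s * z) := by ring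
  rw [fiS3, rhoSum, hF]
  have h1 : ∑ n ∈ Icc 1 ⌊x⌋₊, A.a n * (sieveRho lam n : ℝ) *
      ((truncGT (μ : ArithmeticFunction ℝ) (s * y) * ζ) * truncIoc Λ z (s * z)) n =
      ∑ n ∈ Icc 1 ⌊x⌋₊, (A.a n * (sieveRho lam n : ℝ)) *
        ((truncGT (μ : ArithmeticFunction ℝ) (s * y) * ζ) * truncIoc Λ z (s * z)) n := rfl
  rw [h1, sum_Icc_mul_conv_eq]
  refine Finset.sum_congr rfl fun c _ => ?_
  rw [Finset.mul_sum]
  refine Finset.sum_congr rfl fun k _ => ?_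
  -- `Λ(z<c≤sz) M(k) a_{kc} ρ_{kc} = Λ(z<c≤sz) M(k) ρ_k a_{kc}` termwise
  by_cases ha : A.a (k * c) = 0
  · rw [ha, mul_zero, mul_zero, zero_mul, mul_zero, mul_zero]
  by_cases hΛ : truncIoc Λ z (s * z) c = 0
  · rw [hΛ, zero_mul, zero_mul]
  have hsq : Squarefree (k * c) := by
    by_contra h; exact ha (h116 _ h)
  rw [truncIoc_apply] at hΛ
  have hzc : z < (c : ℝ) ∧ (c : ℝ) ≤ s * z := by
    by_contra h; exact hΛ (if_neg h)
  rw [if_pos hzc] at hΛ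
  have hcp : c.Prime := prime_of_vonMangoldt_ne_zero_of_squarefree hΛ (Squarefree.of_mul_right hsq)
  rw [hw.sieveRho_mul_prime k hcp (hPz.trans hzc.1.le)]
  ring

/-- **`S₃ = S⁺ - S⁻`** (FI §8, `μ(c)Λ(c) = λ⁺(c) - λ⁻(c)`), with the integer truncation point
`C₀ ≥ 1` (we use `C₀ = ⌈x/D⌉`) and `1 ≤ z` (so that `c > z` forces `c ≥ 2`): for weights of sifting
range `P ≤ z`,
`S₃(x; y, z) = ∑_{c,k} [z<c≤sz] M(k)ρ_k μ(c)λ⁺(c) a_{kc} - ∑_{c,k} [z<c≤sz] M(k)ρ_k μ(c)λ⁻(c) a_{kc}`.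
[cite: FriedlanderIwaniecASP1998, §8 p. 1057] -/
theorem fiS3_eq_plus_sub_minus (A : SieveSequence) (h116 : ∀ n : ℕ, ¬Squarefree n → A.a n = 0)
    {P L : ℝ} {lam : ℕ → ℤ} (hw : IsUpperSieveWeights P L lam) {s x y z : ℝ} (hPz : P ≤ z)
    (hz1 : 1 ≤ z) {C₀ : ℕ} (hC : 1 ≤ C₀) :
    A.fiS3 lam s x y z =
      (∑ c ∈ Icc 1 ⌊x⌋₊, ∑ k ∈ Icc 1 (⌊x⌋₊ / c),
        if z < (c : ℝ) ∧ (c : ℝ) ≤ s * z then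
          (truncGT (μ : ArithmeticFunction ℝ) (s * y) * ζ) k * (sieveRho lam k : ℝ) *
            ((μ c : ℝ) * ∑ m ∈ c.divisors, (μ m : ℝ) * Real.posLog ((m : ℝ) / C₀)) * A.a (k * c)
        else 0)
      - ∑ c ∈ Icc 1 ⌊x⌋₊, ∑ k ∈ Icc 1 (⌊x⌋₊ / c),
        if z < (c : ℝ) ∧ (c : ℝ) ≤ s * z then
          (truncGT (μ : ArithmeticFunction ℝ) (s * y) * ζ) k * (sieveRho lam k : ℝ) *
            ((μ c : ℝ) * ∑ m ∈ c.divisors, (μ m : ℝ) * Real.posLog ((C₀ : ℝ) / m)) * A.a (k * c)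
        else 0 := by
  rw [A.fiS3_eq_sum_sum h116 hw hPz, ← Finset.sum_sub_distrib]
  refine Finset.sum_congr rfl fun c hc => ?_
  rw [← Finset.sum_sub_distrib]
  refine Finset.sum_congr rfl fun k _ => ?_
  rw [truncIoc_apply]
  split_ifs with hzc
  · have hc2 : 2 ≤ c := by
      have : (1 : ℝ) < c := lt_of_le_of_lt hz1 hzc.1
      exact_mod_cast this
    have hC0 : (0 : ℝ) < C₀ := by exact_mod_cast hC
    have key := vonMangoldt_mul_a_eq h116 hC0 k hc2
    set M := (truncGT (μ : ArithmeticFunction ℝ) (s * y) * ζ) k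
    set ρ := (sieveRho lam k : ℝ)
    calc Λ c * (M * (ρ * A.a (k * c))) = M * ρ * (Λ c * A.a (k * c)) := by ring
      _ = M * ρ * ((μ c : ℝ) * (∑ m ∈ c.divisors, (μ m : ℝ) * Real.posLog (m / C₀) -
            ∑ m ∈ c.divisors, (μ m : ℝ) * Real.posLog (C₀ / m)) * A.a (k * c)) := by rw [key]
      _ = _ := by ring
  · rw [zero_mul, sub_self]

end SieveSequence

/-! ### `λ⁻` in terms of `γ`, and the bound (8.1) for `S⁻` -/

/-- **`λ⁻(c) = ∫_1^C γ(c, t) t⁻¹ dt`**, discrete form with an integer `C₀ ≥ 1`: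
`∑_{m∣c} μ(m) log⁺(C₀/m) = ∑_{1 ≤ j < C₀} log((j+1)/j) γ(c; j)` (interchange and
telescope: `∑_{m ≤ j < C₀} log((j+1)/j) = log⁺(C₀/m)`). [cite: FriedlanderIwaniecASP1998, §8 p. 1057] -/
theorem sum_divisors_moebius_posLog_eq_sum_gamma (C₀ : ℕ) (c : ℕ) :
    ∑ m ∈ c.divisors, (μ m : ℝ) * Real.posLog ((C₀ : ℝ) / m) =
      ∑ j ∈ Ico 1 C₀, Real.log (((j : ℝ) + 1) / j) * (SieveSequence.fiGamma j c : ℝ) := by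
  classical
  -- expand `γ` and interchange
  have h1 : ∑ j ∈ Ico 1 C₀, Real.log (((j : ℝ) + 1) / j) * (SieveSequence.fiGamma j c : ℝ) =
      ∑ j ∈ Ico 1 C₀, ∑ m ∈ c.divisors,
        if m ≤ j then Real.log (((j : ℝ) + 1) / j) * (μ m : ℝ) else 0 := by
    refine Finset.sum_congr rfl fun j _ => ?_
    rw [SieveSequence.fiGamma, Int.cast_sum, Finset.mul_sum, Finset.sum_filter]
    refine Finset.sum_congr rfl fun m _ => ?_
    simp only [Nat.cast_le]
  rw [h1, Finset.sum_comm]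
  refine Finset.sum_congr rfl fun m hm => ?_
  have hm1 : 1 ≤ m := Nat.pos_of_mem_divisors hm
  have hm0 : (0 : ℝ) < m := by exact_mod_cast hm1
  -- `∑_{j ∈ Ico 1 C₀, m ≤ j} log((j+1)/j) μ(m) = μ(m) ∑_{j ∈ Ico m C₀} (log(j+1) - log j)`
  have h2 : ∑ j ∈ Ico 1 C₀, (if m ≤ j then Real.log (((j : ℝ) + 1) / j) * (μ m : ℝ) else 0) =
      (μ m : ℝ) * ∑ j ∈ Ico m C₀, (Real.log ((j + 1 : ℕ) : ℝ) - Real.log ((j : ℕ) : ℝ)) := by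
    rw [← Finset.sum_filter, Finset.mul_sum]
    have hset : (Ico 1 C₀).filter (fun j => m ≤ j) = Ico m C₀ := by
      ext j; simp only [Finset.mem_filter, Finset.mem_Ico]; omega
    rw [hset]
    refine Finset.sum_congr rfl fun j hj => ?_
    have hj0 : (0 : ℝ) < j := by
      have := (Finset.mem_Ico.mp hj).1
      exact_mod_cast (show 0 < j by omega)
    rw [Real.log_div (by positivity) hj0.ne']
    push_cast
    ring
  rw [h2]
  rcases le_or_gt m C₀ with hmC | hmC
  · rw [Finset.sum_Ico_sub (f := fun j : ℕ => Real.log ((j : ℕ) : ℝ)) hmC]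
    have hq : (1 : ℝ) ≤ (C₀ : ℝ) / m := by
      rw [le_div_iff₀ hm0, one_mul]; exact_mod_cast hmC
    have hC0 : (0 : ℝ) < C₀ := by exact_mod_cast lt_of_lt_of_le hm1 hmC
    rw [Real.posLog_eq_log (by rw [abs_of_nonneg (by positivity)]; exact hq),
      Real.log_div hC0.ne' hm0.ne']
  · have hempty : Ico m C₀ = ∅ := Finset.Ico_eq_empty (by omega)
    have hq : (C₀ : ℝ) / m ≤ 1 := by
      rw [div_le_one hm0]; exact_mod_cast hmC.le
    rw [hempty, Finset.sum_empty, mul_zero, (Real.posLog_eq_zero_iff _).mpr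
      (by rw [abs_of_nonneg (by positivity)]; exact hq), mul_zero]

variable {A : SieveSequence} in
/-- `γ(c; j) μ(c) a_{kc} = μ(k) · γ(c; j) μ(kc) a_{kc}` under (1.16) (compare `sum_moebius_mul_a_eq`).
[cite: FriedlanderIwaniecASP1998, §8 (8.1)] -/
theorem sum_gamma_moebius_mul_a_eq (h116 : ∀ n : ℕ, ¬Squarefree n → A.a n = 0) (k : ℕ) (C : ℝ)
    (S : Finset ℕ) :
    ∑ c ∈ S, (SieveSequence.fiGamma C c : ℝ) * (μ c : ℝ) * A.a (k * c) =
      (μ k : ℝ) * ∑ c ∈ S, (SieveSequence.fiGamma C c : ℝ) * (μ (k * c) : ℝ) * A.a (k * c) := by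
  rw [Finset.mul_sum]
  refine Finset.sum_congr rfl fun c _ => ?_
  by_cases hsq : Squarefree (k * c)
  · have hcop := Nat.coprime_of_squarefree_mul hsq
    have hk : Squarefree k := Squarefree.of_mul_left hsq
    have hμk : (μ k : ℝ) * (μ k : ℝ) = 1 := by
      rw [ArithmeticFunction.moebius_apply_of_squarefree hk]
      push_cast
      rw [← pow_add, ← two_mul, pow_mul]
      norm_num
    rw [ArithmeticFunction.isMultiplicative_moebius.map_mul_of_coprime hcop, Int.cast_mul]
    linear_combination (-(SieveSequence.fiGamma C c : ℝ) * (μ c : ℝ) * A.a (k * c)) * hμk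
  · rw [h116 _ hsq, mul_zero, mul_zero, mul_zero]

/-- `|M(k)| = |∑_{b ∣ k} μ(b > sy)| ≤ τ(k)`. [folklore] -/
theorem abs_truncGT_moebius_mul_zeta_le (u : ℝ) (k : ℕ) :
    |(truncGT (μ : ArithmeticFunction ℝ) u * ζ) k| ≤ (k.divisors.card : ℝ) := by
  rw [ArithmeticFunction.coe_mul_zeta_apply]
  refine (Finset.abs_sum_le_sum_abs _ _).trans ?_
  calc ∑ b ∈ k.divisors, |truncGT (μ : ArithmeticFunction ℝ) u b| ≤ ∑ b ∈ k.divisors, (1 : ℝ) :=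
        Finset.sum_le_sum fun b _ => abs_truncGT_moebius_le u b
    _ = (k.divisors.card : ℝ) := by rw [Finset.sum_const, nsmul_eq_mul, mul_one]

/-- `0 ≤ ρ_k ≤ τ(k)` for upper-bound sieve weights. [folklore] -/
theorem IsUpperSieveWeights.sieveRho_le_card_divisors {P L : ℝ} {lam : ℕ → ℤ}
    (hw : IsUpperSieveWeights P L lam) (k : ℕ) : (sieveRho lam k : ℝ) ≤ (k.divisors.card : ℝ) := by
  rw [sieveRho, Int.cast_sum]
  calc ∑ d ∈ k.divisors, ((lam d : ℤ) : ℝ) ≤ ∑ d ∈ k.divisors, (1 : ℝ) := by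
        refine Finset.sum_le_sum fun d _ => ?_
        have h := hw.abs_le_one d
        have : ((lam d : ℤ) : ℝ) ≤ |((lam d : ℤ) : ℝ)| := le_abs_self _
        have h' : |((lam d : ℤ) : ℝ)| ≤ 1 := by exact_mod_cast h
        linarith
    _ = (k.divisors.card : ℝ) := by rw [Finset.sum_const, nsmul_eq_mul, mul_one]

variable {A : SieveSequence} in
/-- **(8.1): `|S⁻(x; y, z)| ≤ ∑_ℓ τ₄(ℓ) |∑_{z<c≤sz} μ(c)λ⁻(c) a_{cℓ}| ≪ A(x)(log x)⁻¹` by (B′) applied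
`log₂ s` times**, in the explicit form: for `s = 2^{k₀}`, `z ≥ 0`, an integer `C₀ ≥ 1`, weights with
`|λ| ≤ 1`, and (B′) with constant `KB` on every dyadic piece `(2^i z, 2^{i+1} z]`, `i < k₀`, and every
integer truncation `1 ≤ j < C₀`,
`|S⁻(x; y, z)| ≤ log C₀ · k₀ · KB`. [cite: FriedlanderIwaniecASP1998, §8 (8.1)] -/
theorem abs_S3minus_le (h116 : ∀ n : ℕ, ¬Squarefree n → A.a n = 0)
    {P L : ℝ} {lam : ℕ → ℤ} (hw : IsUpperSieveWeights P L lam) {x y z : ℝ} (hx : 0 ≤ x)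
    (hz : 0 ≤ z) (k₀ : ℕ) {C₀ : ℕ} (hC : 1 ≤ C₀) {KB : ℝ}
    (hB : ∀ j ∈ Ico 1 C₀, ∀ i ∈ range k₀, ∑ m ∈ Icc 1 ⌊x⌋₊, (divisorCountK 5 m : ℝ) *
      |∑ n ∈ (Ioc ⌊2 ^ i * z⌋₊ ⌊2 * (2 ^ i * z)⌋₊).filter (fun n : ℕ => ((m * n : ℕ) : ℝ) ≤ x),
        (SieveSequence.fiGamma j n : ℝ) * (μ (m * n) : ℝ) * A.a (m * n)| ≤ KB) :
    |∑ c ∈ Icc 1 ⌊x⌋₊, ∑ k ∈ Icc 1 (⌊x⌋₊ / c),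
        (if z < (c : ℝ) ∧ (c : ℝ) ≤ 2 ^ k₀ * z then
          (truncGT (μ : ArithmeticFunction ℝ) (2 ^ k₀ * y) * ζ) k * (sieveRho lam k : ℝ) *
            ((μ c : ℝ) * ∑ m ∈ c.divisors, (μ m : ℝ) * Real.posLog ((C₀ : ℝ) / m)) * A.a (k * c)
        else 0)| ≤ Real.log C₀ * k₀ * KB := by
  classical
  set X := ⌊x⌋₊ with hX
  set M : ℕ → ℝ := fun k => (truncGT (μ : ArithmeticFunction ℝ) (2 ^ k₀ * y) * ζ) k with hM
  set w : ℕ → ℝ := fun j => Real.log (((j : ℝ) + 1) / j) with hw'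
  have hw0 : ∀ j ∈ Ico 1 C₀, 0 ≤ w j := fun j hj => by
    have hj1 : (1 : ℝ) ≤ j := by exact_mod_cast (Finset.mem_Ico.mp hj).1
    exact Real.log_nonneg (by rw [le_div_iff₀ (by linarith)]; linarith)
  have hwsum : ∑ j ∈ Ico 1 C₀, w j = Real.log C₀ := by
    have h := Finset.sum_Ico_sub (f := fun j : ℕ => Real.log ((j : ℕ) : ℝ)) hC
    simp only [Nat.cast_one, Real.log_one, sub_zero] at h
    rw [← h]
    refine Finset.sum_congr rfl fun j hj => ?_
    have hj0 : (0 : ℝ) < j := by exact_mod_cast (show 0 < j from (Finset.mem_Ico.mp hj).1)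
    show Real.log (((j : ℝ) + 1) / j) = Real.log ((j + 1 : ℕ) : ℝ) - Real.log ((j : ℕ) : ℝ)
    rw [Real.log_div (by positivity) hj0.ne']
    push_cast
    ring
  -- Step 1: insert the `γ`-representation and pull the `j`-sum out
  set T : ℕ → ℕ → ℝ := fun j k =>
    ∑ c ∈ Icc 1 (X / k), (if z < (c : ℝ) ∧ (c : ℝ) ≤ 2 ^ k₀ * z then
      (SieveSequence.fiGamma j c : ℝ) * (μ c : ℝ) * A.a (k * c) else 0) with hT
  have hrepr : ∑ c ∈ Icc 1 X, ∑ k ∈ Icc 1 (X / c),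
      (if z < (c : ℝ) ∧ (c : ℝ) ≤ 2 ^ k₀ * z then
        M k * (sieveRho lam k : ℝ) *
          ((μ c : ℝ) * ∑ m ∈ c.divisors, (μ m : ℝ) * Real.posLog ((C₀ : ℝ) / m)) * A.a (k * c)
        else 0) =
      ∑ j ∈ Ico 1 C₀, w j * ∑ k ∈ Icc 1 X, M k * (sieveRho lam k : ℝ) * T j k := by
    rw [sum_Icc_div_comm (fun k c => if z < (c : ℝ) ∧ (c : ℝ) ≤ 2 ^ k₀ * z then
        M k * (sieveRho lam k : ℝ) *
          ((μ c : ℝ) * ∑ m ∈ c.divisors, (μ m : ℝ) * Real.posLog ((C₀ : ℝ) / m)) * A.a (k * c)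
        else 0) X]
    -- now both sides are `∑ k`; expand the right side
    have hR : ∑ j ∈ Ico 1 C₀, w j * ∑ k ∈ Icc 1 X, M k * (sieveRho lam k : ℝ) * T j k =
        ∑ k ∈ Icc 1 X, ∑ c ∈ Icc 1 (X / k), ∑ j ∈ Ico 1 C₀,
          (if z < (c : ℝ) ∧ (c : ℝ) ≤ 2 ^ k₀ * z then
            w j * (M k * (sieveRho lam k : ℝ) *
              ((SieveSequence.fiGamma j c : ℝ) * (μ c : ℝ) * A.a (k * c))) else 0) := by
      calc ∑ j ∈ Ico 1 C₀, w j * ∑ k ∈ Icc 1 X, M k * (sieveRho lam k : ℝ) * T j k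
          = ∑ j ∈ Ico 1 C₀, ∑ k ∈ Icc 1 X, ∑ c ∈ Icc 1 (X / k),
              (if z < (c : ℝ) ∧ (c : ℝ) ≤ 2 ^ k₀ * z then
                w j * (M k * (sieveRho lam k : ℝ) *
                  ((SieveSequence.fiGamma j c : ℝ) * (μ c : ℝ) * A.a (k * c))) else 0) := by
            refine Finset.sum_congr rfl fun j _ => ?_
            rw [Finset.mul_sum]
            refine Finset.sum_congr rfl fun k _ => ?_
            rw [hT, Finset.mul_sum, Finset.mul_sum]
            refine Finset.sum_congr rfl fun c _ => ?_
            split_ifs <;> ring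
        _ = _ := by
            rw [Finset.sum_comm]
            exact Finset.sum_congr rfl fun k _ => Finset.sum_comm
    rw [hR]
    refine Finset.sum_congr rfl fun k hk => Finset.sum_congr rfl fun c hc => ?_
    split_ifs with hzc
    · have hc0 : c ≠ 0 := by have := (Finset.mem_Icc.mp hc).1; omega
      rw [sum_divisors_moebius_posLog_eq_sum_gamma C₀ c, Finset.mul_sum, Finset.mul_sum,
        Finset.sum_mul]
      exact Finset.sum_congr rfl fun j _ => by ring
    · simp
  rw [hrepr]
  -- Step 2: bound each `j`-term by `k₀ KB`
  have hterm : ∀ j ∈ Ico 1 C₀, |∑ k ∈ Icc 1 X, M k * (sieveRho lam k : ℝ) * T j k| ≤ k₀ * KB := by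
    intro j hj
    -- `|M(k) ρ_k T| ≤ τ₅(k) ∑_i |piece_i|`
    set U : ℕ → ℕ → ℝ := fun i m =>
      |∑ n ∈ (Ioc ⌊2 ^ i * z⌋₊ ⌊2 * (2 ^ i * z)⌋₊).filter (fun n : ℕ => ((m * n : ℕ) : ℝ) ≤ x),
        (SieveSequence.fiGamma j n : ℝ) * (μ (m * n) : ℝ) * A.a (m * n)| with hU
    have hTk : ∀ k ∈ Icc 1 X, |T j k| ≤ ∑ i ∈ range k₀, U i k := by
      intro k hk
      have hk1 : 1 ≤ k := (Finset.mem_Icc.mp hk).1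
      rw [hT]
      dsimp only
      rw [sum_ite_Ioc_pow_eq_sum_range (fun c => (SieveSequence.fiGamma j c : ℝ) * (μ c : ℝ) * A.a (k * c))
        hz k₀ hx hk1]
      refine (Finset.abs_sum_le_sum_abs _ _).trans (Finset.sum_le_sum fun i _ => ?_)
      rw [sum_gamma_moebius_mul_a_eq h116 k j, abs_mul]
      have hμ : |(μ k : ℝ)| ≤ 1 := by exact_mod_cast ArithmeticFunction.abs_moebius_le_one
      calc |(μ k : ℝ)| * U i k ≤ 1 * U i k := mul_le_mul_of_nonneg_right hμ (abs_nonneg _)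
        _ = U i k := one_mul _
    -- if `k` is not squarefree then `T j k = 0`
    have hTsq : ∀ k : ℕ, ¬Squarefree k → T j k = 0 := by
      intro k hk
      rw [hT]
      refine Finset.sum_eq_zero fun c _ => ?_
      split_ifs
      · rw [h116 _ (fun h => hk (Squarefree.of_mul_left h)), mul_zero]
      · rfl
    calc |∑ k ∈ Icc 1 X, M k * (sieveRho lam k : ℝ) * T j k|
        ≤ ∑ k ∈ Icc 1 X, |M k * (sieveRho lam k : ℝ) * T j k| := Finset.abs_sum_le_sum_abs _ _
      _ ≤ ∑ k ∈ Icc 1 X, (divisorCountK 5 k : ℝ) * ∑ i ∈ range k₀, U i k := by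
          refine Finset.sum_le_sum fun k hk => ?_
          by_cases hksq : Squarefree k
          · rw [abs_mul, abs_mul]
            have h1 : |M k| ≤ (k.divisors.card : ℝ) := abs_truncGT_moebius_mul_zeta_le _ k
            have h2 : |(sieveRho lam k : ℝ)| ≤ (k.divisors.card : ℝ) := by
              rw [abs_of_nonneg (by exact_mod_cast hw.sieveRho_nonneg k)]
              exact hw.sieveRho_le_card_divisors k
            have h3 : (k.divisors.card : ℝ) * (k.divisors.card : ℝ) ≤ (divisorCountK 5 k : ℝ) := by
              rw [← sq]; exact card_divisors_sq_le_divisorCountK_five hksq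
            calc |M k| * |(sieveRho lam k : ℝ)| * |T j k|
                ≤ (k.divisors.card : ℝ) * (k.divisors.card : ℝ) * ∑ i ∈ range k₀, U i k :=
                  mul_le_mul (mul_le_mul h1 h2 (abs_nonneg _) (Nat.cast_nonneg _)) (hTk k hk)
                    (abs_nonneg _) (by positivity)
              _ ≤ (divisorCountK 5 k : ℝ) * ∑ i ∈ range k₀, U i k :=
                  mul_le_mul_of_nonneg_right h3 (Finset.sum_nonneg fun i _ => abs_nonneg _)
          · rw [hTsq k hksq, mul_zero, abs_zero]
            exact mul_nonneg (Nat.cast_nonneg _) (Finset.sum_nonneg fun i _ => abs_nonneg _)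
      _ = ∑ i ∈ range k₀, ∑ k ∈ Icc 1 X, (divisorCountK 5 k : ℝ) * U i k := by
          rw [Finset.sum_comm]
          exact Finset.sum_congr rfl fun k _ => by rw [Finset.mul_sum]
      _ ≤ ∑ i ∈ range k₀, KB := Finset.sum_le_sum fun i hi => hB j hj i hi
      _ = k₀ * KB := by rw [Finset.sum_const, Finset.card_range, nsmul_eq_mul]
  -- Step 3: sum over `j`
  calc |∑ j ∈ Ico 1 C₀, w j * ∑ k ∈ Icc 1 X, M k * (sieveRho lam k : ℝ) * T j k|
      ≤ ∑ j ∈ Ico 1 C₀, |w j * ∑ k ∈ Icc 1 X, M k * (sieveRho lam k : ℝ) * T j k| :=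
        Finset.abs_sum_le_sum_abs _ _
    _ ≤ ∑ j ∈ Ico 1 C₀, w j * (k₀ * KB) := by
        refine Finset.sum_le_sum fun j hj => ?_
        rw [abs_mul, abs_of_nonneg (hw0 j hj)]
        exact mul_le_mul_of_nonneg_left (hterm j hj) (hw0 j hj)
    _ = Real.log C₀ * k₀ * KB := by rw [← Finset.sum_mul, hwsum, mul_assoc]

end Literature.NumberTheory.Sieve
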